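import Summits.QuantumFields.YangMills.Theorems.TwoPointSynchronisation.Negative.IndicatorPatterns

/-!
# `TwoPointSynchronisation` — negative lemma, part II: no uniform exponential rate for indicator
# observables without coalescence (`exists_slow_set`)

Support file II (of three) for crux `stmt-QuantumFields-17976`
(`Summit.QuantumFields.YangMills.Theses.NoiseSynchronisation.TwoPointSynchronisation`). Pure measure theory;
tree/Mathlib objects only; nothing is posited; axioms `propext`, `Classical.choice`, `Quot.sound`.

`exists_slow_set`: on a probability space `(Λ, M)` let `u k, v k : Λ → ℝ` (`k ∈ ℕ`) be measurable with a common
law `ν` (`M.map (u k) = M.map (v k) = ν` for all `k`) and NON-COALESCING, `M{u k = v k} = 0` for all `k`. Then for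
every rate `γ > 0` there is a Borel set `E ⊂ ℝ` such that for every `C` some `k` has
`C e^{−γk} < M((u k)⁻¹ E ∆ (v k)⁻¹ E)` — the indicator observable `1_E` does not synchronise at rate `γ`.
Proof. If `ν` has an atom `c`: `E = {c}`. Otherwise the cdf of `ν` is continuous (`continuous_cdf_of_noAtoms`,
Stieltjes jump = point mass) and downward intermediate values exist (`exists_cdf_eq`): blocks
`B_i = (a_{i+1}, a_i]` with `cdf a_{i+1} = cdf a_i / 25`, masses `m_i = ν B_i > 0`, tails `ν(−∞, a_{i+1}] = m_i/24`;
times `k_i` with `e^{−γ k_i} ≤ m_i/(i+1)` (`exists_exp_le`); scales `δ_i > 0` with `M(|u − v| < δ_i) ≤ m_i/20` at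
time `k_i` (continuity from above down to the null coalescence event); cells of width `δ_i`
(`floor_mem_Icc`); bit patterns chosen sequentially in `i` by `exists_pattern` (part I)
against the union `F_i` of the earlier patterns; `E = ⋃_i patterns`. At time `k_i`, outside the tail event
`{v ≤ a_{i+1}}`, membership in `E` of `u ∈ B_i` and of `v` is membership in `pattern_i ∪ F_i`, so
`M(1_E(u) ≠ 1_E(v)) ≥ ½(m_i − m_i/20) − m_i/24 ≥ (2/5) m_i ≥ (2/5)(i+1) e^{−γ k_i}`.
-/

set_option autoImplicit false

noncomputable section

open MeasureTheory Set Filter Topology ProbabilityTheory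
open scoped ENNReal

namespace Summit.QuantumFields.YangMills.Theorems.TwoPointSynchronisation.Negative

/-! ### Small analytic helpers -/

/-- `e^{-γk} ≤ m` for some natural `k` (`γ, m > 0`). [folklore] -/
theorem exists_exp_le {γ : ℝ} (hγ : 0 < γ) {m : ℝ} (hm : 0 < m) :
    ∃ k : ℕ, Real.exp (-(γ * k)) ≤ m := by
  obtain ⟨k, hk⟩ := exists_nat_gt (1 / (m * γ))
  refine ⟨k, ?_⟩
  have hk' : 1 / m < γ * k := by
    rw [div_lt_iff₀ (mul_pos hm hγ)] at hk
    rw [div_lt_iff₀ hm]; nlinarith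
  have h1 : 1 / m ≤ Real.exp (γ * k) := le_trans hk'.le (by linarith [Real.add_one_le_exp (γ * k)])
  rw [Real.exp_neg]
  calc (Real.exp (γ * k))⁻¹ ≤ (1 / m)⁻¹ := inv_anti₀ (by positivity) h1
    _ = m := by rw [one_div, inv_inv]

/-- `C e^{-γk} < m` for some natural `k` (`γ, m > 0`, any real `C`). [folklore] -/
theorem exists_mul_exp_lt {γ : ℝ} (hγ : 0 < γ) {m : ℝ} (hm : 0 < m) (C : ℝ) :
    ∃ k : ℕ, C * Real.exp (-(γ * k)) < m := by
  by_cases hC : C ≤ 0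
  · exact ⟨0, lt_of_le_of_lt (mul_nonpos_of_nonpos_of_nonneg hC (Real.exp_nonneg _)) hm⟩
  · push Not at hC
    obtain ⟨k, hk⟩ := exists_exp_le hγ (m := m / (2 * C)) (by positivity)
    refine ⟨k, ?_⟩
    calc C * Real.exp (-(γ * k)) ≤ C * (m / (2 * C)) := by gcongr
      _ = m / 2 := by field_simp
      _ < m := by linarith

/-- The cells meeting `(a, b]` have indices in `[⌊a/w⌋, ⌊b/w⌋]`. [folklore] -/
theorem floor_mem_Icc {w : ℝ} (hw : 0 < w) {a b x : ℝ} (hx : x ∈ Ioc a b) :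
    ⌊x / w⌋ ∈ Finset.Icc ⌊a / w⌋ ⌊b / w⌋ := by
  rw [Finset.mem_Icc]
  exact ⟨Int.floor_mono (div_le_div_of_nonneg_right hx.1.le hw.le),
    Int.floor_mono (div_le_div_of_nonneg_right hx.2 hw.le)⟩

/-! ### The cdf of an atomless probability measure on `ℝ` is continuous; IVT downwards -/

section CDF

variable (ν : Measure ℝ) [IsProbabilityMeasure ν]

/-- The cdf of an atomless probability measure on `ℝ` is continuous (Stieltjes: the jump at `a` is the mass of `{a}`). [folklore] -/
theorem continuous_cdf_of_noAtoms (hna : ∀ c : ℝ, ν {c} = 0) : Continuous (cdf ν) := by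
  rw [continuous_iff_continuousAt]
  intro a
  rw [(monotone_cdf ν).continuousAt_iff_leftLim_eq_rightLim, StieltjesFunction.rightLim_eq]
  have h1 : Function.leftLim (cdf ν) a ≤ cdf ν a := (monotone_cdf ν).leftLim_le le_rfl
  have h2 : (cdf ν).measure {a} = ENNReal.ofReal (cdf ν a - Function.leftLim (cdf ν) a) :=
    StieltjesFunction.measure_singleton _ a
  rw [measure_cdf, hna a, eq_comm, ENNReal.ofReal_eq_zero] at h2
  linarith

/-- Downward intermediate values of an atomless cdf: every level `0 < y ≤ F(a)` is attained at some `x ≤ a`. [folklore] -/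
theorem exists_cdf_eq (hna : ∀ c : ℝ, ν {c} = 0) (a : ℝ) {y : ℝ} (hy : 0 < y) (hya : y ≤ cdf ν a) :
    ∃ x, x ≤ a ∧ cdf ν x = y := by
  obtain ⟨z, hz⟩ := ((tendsto_cdf_atBot ν).eventually (gt_mem_nhds hy)).exists
  have hza : z ≤ a := by
    by_contra h
    push Not at h
    have := (monotone_cdf ν) h.le
    linarith
  obtain ⟨x, hx, hxy⟩ := intermediate_value_Icc hza (continuous_cdf_of_noAtoms ν hna).continuousOn
    ⟨hz.le, hya⟩
  exact ⟨x, hx.2, hxy⟩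

omit [IsProbabilityMeasure ν] in
/-- Some point has cdf at least `1/2`. [folklore] -/
theorem exists_cdf_ge_half : ∃ a : ℝ, 1 / 2 ≤ cdf ν a := by
  obtain ⟨a, ha⟩ := ((tendsto_cdf_atTop ν).eventually (lt_mem_nhds (by norm_num : (1/2 : ℝ) < 1))).exists
  exact ⟨a, ha.le⟩

/-- `ν(a,b] = F(b) - F(a)`. [folklore] -/
theorem real_Ioc_eq_cdf_sub (a b : ℝ) (hab : a ≤ b) : ν.real (Ioc a b) = cdf ν b - cdf ν a := by
  have h := (cdf ν).measure_Ioc a b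
  rw [measure_cdf] at h
  rw [measureReal_def, h, ENNReal.toReal_ofReal (sub_nonneg.2 ((monotone_cdf ν) hab))]

/-- `ν(-∞,a] = F(a)`. [folklore] -/
theorem real_Iic_eq_cdf (a : ℝ) : ν.real (Iic a) = cdf ν a := (cdf_eq_real ν a).symm

end CDF


variable {Λ : Type*} [MeasurableSpace Λ]

/-- Transfer of real masses along a law: `M(f ∈ S) = ν(S)` when `law(f) = ν`. [folklore] -/
theorem real_preimage_eq {M : Measure Λ} {f : Λ → ℝ} (hf : Measurable f) {ν : Measure ℝ}
    (h : M.map f = ν) {S : Set ℝ} (hS : MeasurableSet S) : M.real (f ⁻¹' S) = ν.real S := by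
  rw [measureReal_def, measureReal_def, ← h, Measure.map_apply hf hS]

/-- **No uniform exponential rate for indicator observables without coalescence.**
If `u k`, `v k` all have the same law `ν` and never coincide, then for every rate `γ > 0` some
Borel set `E` has `sup_k e^{γ k} · M(1_E(u k) ≠ 1_E(v k)) = ∞`. [folklore] -/
theorem exists_slow_set (M : Measure Λ) [IsProbabilityMeasure M] (u v : ℕ → Λ → ℝ)
    (hu : ∀ k, Measurable (u k)) (hv : ∀ k, Measurable (v k)) (ν : Measure ℝ)
    [IsProbabilityMeasure ν] (hlu : ∀ k, M.map (u k) = ν) (hlv : ∀ k, M.map (v k) = ν)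
    (hnc : ∀ k, M {p | u k p = v k p} = 0) {γ : ℝ} (hγ : 0 < γ) :
    ∃ E : Set ℝ, MeasurableSet E ∧ ∀ C : ℝ, ∃ k : ℕ,
      C * Real.exp (-(γ * k)) < M.real (symmDiff (u k ⁻¹' E) (v k ⁻¹' E)) := by
  classical
  by_cases hat : ∃ c, ν {c} ≠ 0
  · -- ν has an atom `c`: the indicator of `{c}` never synchronises at all
    obtain ⟨c, hc⟩ := hat
    have hm : 0 < ν.real {c} := by
      rw [measureReal_def]; exact ENNReal.toReal_pos hc (measure_ne_top ν _)
    refine ⟨{c}, measurableSet_singleton c, fun C => ?_⟩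
    obtain ⟨k, hk⟩ := exists_mul_exp_lt hγ hm C
    refine ⟨k, lt_of_lt_of_le hk ?_⟩
    rw [← real_preimage_eq (hu k) (hlu k) (measurableSet_singleton c)]
    have hsub : u k ⁻¹' {c} \ {p | u k p = v k p} ⊆ symmDiff (u k ⁻¹' {c}) (v k ⁻¹' {c}) := by
      intro p hp
      rw [mem_symmDiff]
      refine Or.inl ⟨hp.1, fun hv' => hp.2 ?_⟩
      have h1 : u k p = c := hp.1
      have h2 : v k p = c := hv'
      exact h1.trans h2.symm
    have hle : M (u k ⁻¹' {c}) ≤ M (symmDiff (u k ⁻¹' {c}) (v k ⁻¹' {c})) :=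
      calc M (u k ⁻¹' {c}) ≤ M (u k ⁻¹' {c} \ {p | u k p = v k p} ∪ {p | u k p = v k p}) :=
            measure_mono (subset_sdiff_union _ _)
        _ ≤ M (u k ⁻¹' {c} \ {p | u k p = v k p}) + M {p | u k p = v k p} := measure_union_le _ _
        _ = M (u k ⁻¹' {c} \ {p | u k p = v k p}) := by rw [hnc k, add_zero]
        _ ≤ _ := measure_mono hsub
    simpa [measureReal_def] using ENNReal.toReal_mono (measure_ne_top M _) hle
  · -- atomless case
    push Not at hat
    have hIVT := exists_cdf_eq ν hat
    obtain ⟨a0, ha0⟩ := exists_cdf_ge_half ν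
    have hex : ∀ x : {x : ℝ // 0 < cdf ν x}, ∃ z, z ≤ x.1 ∧ cdf ν z = cdf ν x.1 / 25 := fun x =>
      hIVT x.1 (div_pos x.2 (by norm_num)) (by linarith [x.2])
    let step : {x : ℝ // 0 < cdf ν x} → {x : ℝ // 0 < cdf ν x} := fun x =>
      ⟨Classical.choose (hex x), by
        rw [(Classical.choose_spec (hex x)).2]; exact div_pos x.2 (by norm_num)⟩
    let aS : ℕ → {x : ℝ // 0 < cdf ν x} := fun n => step^[n] ⟨a0, by linarith⟩
    let a : ℕ → ℝ := fun n => (aS n).1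
    have haS_succ : ∀ n, aS (n + 1) = step (aS n) := fun n => Function.iterate_succ_apply' step n _
    have ha_succ : ∀ n, a (n + 1) ≤ a n ∧ cdf ν (a (n + 1)) = cdf ν (a n) / 25 := by
      intro n
      show (aS (n + 1)).1 ≤ (aS n).1 ∧ cdf ν (aS (n + 1)).1 = cdf ν (aS n).1 / 25
      rw [haS_succ]
      exact Classical.choose_spec (hex (aS n))
    have ha_pos : ∀ n, 0 < cdf ν (a n) := fun n => (aS n).2
    have ha_anti : Antitone a := antitone_nat_of_succ_le fun n => (ha_succ n).1
    -- blocks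
    let B : ℕ → Set ℝ := fun n => Ioc (a (n + 1)) (a n)
    let m : ℕ → ℝ := fun n => ν.real (B n)
    have hm_eq' : ∀ n, m n = 24 * cdf ν (a (n + 1)) := by
      intro n
      show ν.real (Ioc (a (n + 1)) (a n)) = _
      rw [real_Ioc_eq_cdf_sub ν _ _ (ha_succ n).1, (ha_succ n).2]; ring
    have hm_pos : ∀ n, 0 < m n := fun n => by rw [hm_eq']; exact mul_pos (by norm_num) (ha_pos _)
    have htail : ∀ n, ν.real (Iic (a (n + 1))) = m n / 24 := by
      intro n; rw [real_Iic_eq_cdf, hm_eq']; ring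
    have hBm : ∀ n, MeasurableSet (B n) := fun n => measurableSet_Ioc
    -- times
    have hk : ∀ n : ℕ, ∃ k : ℕ, Real.exp (-(γ * k)) ≤ m n / (n + 1) := fun n =>
      exists_exp_le hγ (div_pos (hm_pos n) (by positivity))
    let kk : ℕ → ℕ := fun n => Classical.choose (hk n)
    have hkk : ∀ n : ℕ, Real.exp (-(γ * kk n)) ≤ m n / (n + 1) := fun n =>
      Classical.choose_spec (hk n)
    let uu : ℕ → Λ → ℝ := fun n => u (kk n)
    let vv : ℕ → Λ → ℝ := fun n => v (kk n)
    -- scales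
    have hδ : ∀ n, ∃ δ : ℝ, 0 < δ ∧ M.real {p | |uu n p - vv n p| < δ} ≤ m n / 20 := by
      intro n
      let Sset : ℕ → Set Λ := fun i => {p | |uu n p - vv n p| < 1 / ((i : ℝ) + 1)}
      have hSm : ∀ i, MeasurableSet (Sset i) := fun i =>
        measurableSet_lt (continuous_abs.measurable.comp ((hu _).sub (hv _))) measurable_const
      have hanti : Antitone Sset := by
        intro i j hij p hp
        have hp' : |uu n p - vv n p| < 1 / ((j : ℝ) + 1) := hp
        show |uu n p - vv n p| < 1 / ((i : ℝ) + 1)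
        refine lt_of_lt_of_le hp' ?_
        gcongr
      have hinter : ⋂ i, Sset i ⊆ {p | uu n p = vv n p} := by
        intro p hp
        rw [mem_iInter] at hp
        by_contra hne
        have hpos : 0 < |uu n p - vv n p| := abs_pos.2 (sub_ne_zero.2 hne)
        obtain ⟨i, hi⟩ := exists_nat_gt (1 / |uu n p - vv n p|)
        have h1 : |uu n p - vv n p| < 1 / ((i : ℝ) + 1) := hp i
        rw [lt_div_iff₀ (by positivity)] at h1
        rw [div_lt_iff₀ hpos] at hi
        nlinarith
      have hlim : Tendsto (M ∘ Sset) atTop (𝓝 (M (⋂ i, Sset i))) :=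
        tendsto_measure_iInter_atTop (fun i => (hSm i).nullMeasurableSet) hanti
          ⟨0, measure_ne_top _ _⟩
      have h0 : M (⋂ i, Sset i) = 0 := measure_mono_null hinter (hnc _)
      rw [h0] at hlim
      have hpos' : (0 : ℝ≥0∞) < ENNReal.ofReal (m n / 20) := by
        rw [ENNReal.ofReal_pos]; exact div_pos (hm_pos n) (by norm_num)
      obtain ⟨i, hi⟩ := (hlim.eventually (gt_mem_nhds hpos')).exists
      refine ⟨1 / ((i : ℝ) + 1), by positivity, ?_⟩
      have hle : M (Sset i) ≤ ENNReal.ofReal (m n / 20) := le_of_lt hi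
      exact ENNReal.toReal_le_of_le_ofReal (by linarith [hm_pos n]) hle
    let δ : ℕ → ℝ := fun n => Classical.choose (hδ n)
    have hδpos : ∀ n, 0 < δ n := fun n => (Classical.choose_spec (hδ n)).1
    have hδle : ∀ n, M.real {p | |uu n p - vv n p| < δ n} ≤ m n / 20 := fun n =>
      (Classical.choose_spec (hδ n)).2
    -- cells
    let J : ℕ → Finset ℤ := fun n => Finset.Icc ⌊a (n + 1) / δ n⌋ ⌊a n / δ n⌋
    have hJ : ∀ n, ∀ x ∈ B n, ⌊x / δ n⌋ ∈ J n := fun n x hx => floor_mem_Icc (hδpos n) hx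
    -- patterns as a function of the previously fixed set
    have hpat : ∀ n (F : Set ℝ), MeasurableSet F → Disjoint F (B n) → ∃ b : J n → Bool,
        M.real (goodSet (uu n) (vv n) (δ n) (B n)) ≤
          2 * M.real (disagreeSet (uu n) (vv n) (δ n) (B n) F (extBits (J n) b)) :=
      fun n F hF hFB => exists_pattern M (hu _) (hv _) (δ n) (hBm n) hF hFB (J n) (hJ n)
    let pat : ℕ → Set ℝ → (ℤ → Bool) := fun n F =>
      if hF : MeasurableSet F ∧ Disjoint F (B n) then
        extBits (J n) (Classical.choose (hpat n F hF.1 hF.2)) else fun _ => false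
    let pattOf : ℕ → Set ℝ → Set ℝ := fun n F => patternSet (δ n) (B n) (pat n F)
    let F : ℕ → Set ℝ := fun n => Nat.rec ∅ (fun i Fi => Fi ∪ pattOf i Fi) n
    have hF_zero : F 0 = ∅ := rfl
    have hF_succ : ∀ n, F (n + 1) = F n ∪ pattOf n (F n) := fun n => rfl
    let patt : ℕ → Set ℝ := fun n => pattOf n (F n)
    have hpatt_sub : ∀ n, patt n ⊆ B n := fun n => inter_subset_left
    have hpatt_meas : ∀ n, MeasurableSet (patt n) := fun n => measurableSet_patternSet _ (hBm n) _
    have hF_meas : ∀ n, MeasurableSet (F n) := by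
      intro n
      induction n with
      | zero => rw [hF_zero]; exact MeasurableSet.empty
      | succ n ih => rw [hF_succ]; exact ih.union (hpatt_meas n)
    have hF_mem : ∀ n x, x ∈ F n ↔ ∃ i < n, x ∈ patt i := by
      intro n
      induction n with
      | zero => intro x; simp [hF_zero]
      | succ n ih =>
        intro x
        rw [hF_succ, mem_union, ih]
        constructor
        · rintro (⟨i, hi, hx⟩ | hx)
          · exact ⟨i, Nat.lt_succ_of_lt hi, hx⟩
          · exact ⟨n, Nat.lt_succ_self n, hx⟩
        · rintro ⟨i, hi, hx⟩
          rcases Nat.lt_succ_iff_lt_or_eq.1 hi with hi | rfl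
          · exact Or.inl ⟨i, hi, hx⟩
          · exact Or.inr hx
    have hF_sub : ∀ n, F n ⊆ Ioi (a n) := by
      intro n x hx
      obtain ⟨i, hi, hxi⟩ := (hF_mem n x).1 hx
      have hxB := hpatt_sub i hxi
      exact lt_of_le_of_lt (ha_anti (Nat.succ_le_of_lt hi)) hxB.1
    have hF_disj : ∀ n, Disjoint (F n) (B n) := by
      intro n
      rw [Set.disjoint_left]
      intro x hxF hxB
      exact lt_irrefl _ (lt_of_lt_of_le (hF_sub n hxF) hxB.2)
    -- the slow set
    let E : Set ℝ := ⋃ n, patt n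
    have hE_meas : MeasurableSet E := MeasurableSet.iUnion hpatt_meas
    have hE_mem : ∀ n x, a (n + 1) < x → (x ∈ E ↔ x ∈ patt n ∪ F n) := by
      intro n x hx
      constructor
      · intro hxE
        obtain ⟨i, hxi⟩ := mem_iUnion.1 hxE
        rcases lt_trichotomy i n with hi | rfl | hi
        · exact Or.inr ((hF_mem n x).2 ⟨i, hi, hxi⟩)
        · exact Or.inl hxi
        · exfalso
          have hxB := hpatt_sub i hxi
          exact lt_irrefl _ (lt_of_le_of_lt (hxB.2.trans (ha_anti (Nat.succ_le_of_lt hi))) hx)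
      · rintro (hx' | hx')
        · exact mem_iUnion.2 ⟨n, hx'⟩
        · obtain ⟨i, -, hxi⟩ := (hF_mem n x).1 hx'
          exact mem_iUnion.2 ⟨i, hxi⟩
    refine ⟨E, hE_meas, fun C => ?_⟩
    obtain ⟨n, hn⟩ := exists_nat_gt (C / (2 / 5))
    refine ⟨kk n, ?_⟩
    -- the pattern used at stage n is a genuine choice
    have hpat_n : M.real (goodSet (uu n) (vv n) (δ n) (B n)) ≤
        2 * M.real (disagreeSet (uu n) (vv n) (δ n) (B n) (F n) (pat n (F n))) := by
      have hcond : MeasurableSet (F n) ∧ Disjoint (F n) (B n) := ⟨hF_meas n, hF_disj n⟩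
      have hpn : pat n (F n) = extBits (J n) (Classical.choose (hpat n (F n) hcond.1 hcond.2)) := by
        show (if hF : MeasurableSet (F n) ∧ Disjoint (F n) (B n) then
          extBits (J n) (Classical.choose (hpat n (F n) hF.1 hF.2)) else fun _ => false) = _
        rw [dif_pos hcond]
      rw [hpn]
      exact Classical.choose_spec (hpat n (F n) hcond.1 hcond.2)
    -- lower bound for the good pairs
    have hgood : m n - m n / 20 ≤ M.real (goodSet (uu n) (vv n) (δ n) (B n)) := by
      have hsub : (uu n ⁻¹' B n) \ {p | |uu n p - vv n p| < δ n} ⊆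
          goodSet (uu n) (vv n) (δ n) (B n) := by
        rintro p ⟨hpB, hpfar⟩
        refine ⟨hpB, fun hcell => hpfar ?_⟩
        have h1 : |vv n p - uu n p| < δ n := by
          have h' := Int.abs_sub_lt_one_of_floor_eq_floor hcell.2
          rwa [← sub_div, abs_div, abs_of_pos (hδpos n), div_lt_one (hδpos n)] at h'
        show |uu n p - vv n p| < δ n
        rwa [abs_sub_comm] at h1
      have h1 : M.real (uu n ⁻¹' B n) = m n := real_preimage_eq (hu _) (hlu _) (hBm n)
      calc m n - m n / 20 ≤ M.real (uu n ⁻¹' B n) - M.real {p | |uu n p - vv n p| < δ n} := by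
            rw [h1]; linarith [hδle n]
        _ ≤ M.real ((uu n ⁻¹' B n) \ {p | |uu n p - vv n p| < δ n}) := le_measureReal_sdiff
        _ ≤ _ := measureReal_mono hsub
    -- the disagreement set minus the tail lies in the symmetric difference
    have hAsub : disagreeSet (uu n) (vv n) (δ n) (B n) (F n) (pat n (F n)) \
        (vv n ⁻¹' Iic (a (n + 1))) ⊆ symmDiff (uu n ⁻¹' E) (vv n ⁻¹' E) := by
      rintro p ⟨⟨hgoodp, hdis⟩, hvtail⟩
      have hu_gt : a (n + 1) < uu n p := hgoodp.1.1
      have hv_gt : a (n + 1) < vv n p := not_le.1 hvtail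
      rw [mem_symmDiff, mem_preimage, mem_preimage, hE_mem n _ hu_gt, hE_mem n _ hv_gt]
      simpa only [mem_symmDiff, mem_preimage] using hdis
    have hfinal : m n * (2 / 5) ≤ M.real (symmDiff (uu n ⁻¹' E) (vv n ⁻¹' E)) := by
      have h2 : M.real (vv n ⁻¹' Iic (a (n + 1))) = m n / 24 := by
        rw [real_preimage_eq (hv _) (hlv _) measurableSet_Iic, htail]
      calc m n * (2 / 5)
          ≤ M.real (disagreeSet (uu n) (vv n) (δ n) (B n) (F n) (pat n (F n))) -
              M.real (vv n ⁻¹' Iic (a (n + 1))) := by rw [h2]; linarith [hpat_n, hgood, hm_pos n]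
        _ ≤ M.real (disagreeSet (uu n) (vv n) (δ n) (B n) (F n) (pat n (F n)) \
              (vv n ⁻¹' Iic (a (n + 1)))) := le_measureReal_sdiff
        _ ≤ _ := measureReal_mono hAsub
    have hexp : ((n : ℝ) + 1) * Real.exp (-(γ * kk n)) ≤ m n := by
      have := hkk n
      rw [le_div_iff₀ (by positivity)] at this
      linarith
    have hC : C < 2 / 5 * ((n : ℝ) + 1) := by
      rw [div_lt_iff₀ (by norm_num)] at hn; linarith
    calc C * Real.exp (-(γ * kk n)) < 2 / 5 * ((n : ℝ) + 1) * Real.exp (-(γ * kk n)) :=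
          mul_lt_mul_of_pos_right hC (Real.exp_pos _)
      _ = 2 / 5 * (((n : ℝ) + 1) * Real.exp (-(γ * kk n))) := by ring
      _ ≤ 2 / 5 * m n := by gcongr
      _ = m n * (2 / 5) := by ring
      _ ≤ _ := hfinal

end Summit.QuantumFields.YangMills.Theorems.TwoPointSynchronisation.Negative

end
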